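import Mathlib
import HarnessLib
import Summits.Ventures.LatticeQCDFlow.Scaling.AutoregressiveGaugeKLExtensiveAllPlanes
import Literature.MathematicalPhysics.QuantumFieldTheory.LatticeGaugePlaquetteLowerBound
import Literature.Barriers.QuantumFields.CenterSymmetryBreakingByQuarks

/-!
# LatticeQCDFlow / Scaling — THE VOLUME LAW AT STRONG COUPLING, UNIFORMLY IN THE VOLUME, FOR `SU(n)`:
# an endpoint-blind autoregressive model of `SU(n)` Wilson lattice gauge theory (`n ≥ 2`, `d ≥ 2`) at
# `0 < β ≤ β₁` has training loss `≥ (d·#sites/4)·c(β)²/2` and drives an exact sampler with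
# `τ_int(sign) ≥ exp((d·#sites/4)·c(β)²/2) − ½`, `c(β) = β e^{−2βn} V₀/n − C_d (β/β₁)²` volume-free

HONEST FRAMING: exact (Metropolis-corrected) sampling algorithms for lattice gauge theory;
figures of merit are autocorrelation/cost numbers at stated couplings and volumes; no
continuum-physics claim.

Venture `LatticeQCDFlow` (cell pub-lqcd), topic `Scaling`, FANOUT row 30 (lean-1, GEN-21) — OUR WORK on
THEORY-2.md §4 row C5, the strong-coupling end of the volume law.  `Scaling/AutoregressiveGaugeKLExtensiveAllPlanes`
states the law with ANY common lower bound `w ≥ 0` of the plaquette means; the tree's first-order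
strong-coupling expansion (`Literature/…/LatticeGaugePlaquetteLowerBound.wilsonExpectation_plaquette_ge`,
Osterwalder–Seiler / Montvay–Münster, polymer expansion of the torus plaquette system) supplies, for the
`SU(n)` models, the VOLUME-FREE floor `c(β) = n⁻¹ β e^{−2βn} V₀ − (2e^{1/2})^{4·2^d d²} (β/β₁)²` on every
torus `(ℤ/(L+1))^d`, `L ≥ 2`, for `0 ≤ β ≤ β₁`.  Here the two are joined: at strong coupling, too, the
cost of an endpoint-blind exact sampler is exponential in the volume, uniformly in the volume.

## What is proved (all [ours])

* §1 `wilsonExpectation_plaquette_eq` — all plaquettes of the periodic lattice have the same normalised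
  mean `⟨(1/N)Re tr ρ(U_{x,ij})⟩_β` (from the tree's equality of mean plaquette costs);
  `wilsonExpectation_plaquette_ge_strongCoupling` — the strong-coupling floor at EVERY plaquette of
  `(ℤ/(L+1))^d` for an `SU(n)` model `ρ` (`IsSpecialUnitaryModel ρ`, `n ≥ 2`, `d ≥ 2`, `0 ≤ β ≤ β₁`).
* §2 **`sun_kl_arHybrid_ge_strongCoupling`** — `G = SU(n)` (`Matrix.specialUnitaryGroup (Fin n) ℂ`,
  fundamental representation), `n ≥ 2`, `d ≥ 2`, torus `(ℤ/(L+1))^d` with `L ≥ 2`, `0 < β ≤ β₁`,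
  `0 ≤ c(β)`; ANY duplicate-free generation order of all links and any autoregressive model with squeezed
  normalised conditionals, the conditional at each link blind to the other links at one endpoint of that
  link: `(d·(L+1)^d/4)·c(β)²/2 ≤ KL(e^{−βS_W}/Z ‖ H_l)`.
* §3 **`sun_tauInt_sign_ge_exp_strongCoupling`**, **`sun_invKish_ge_exp_strongCoupling`** —
  `exp((d·(L+1)^d/4)·c(β)²/2) − ½ ≤ τ_int(g)` for every measurable balanced sign observable of the exact
  sampler, and `exp((d·(L+1)^d/4)·c(β)²/2) ≤ 1/κ`.

READING (value-free): for `SU(n)` lattice gauge theory in any dimension `d ≥ 2` there is an explicit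
`β₁(d, n) > 0` such that for every `0 < β ≤ β₁` with `c(β) ≥ 0` (all small `β`: `c(β) = β·V₀ e^{−2βn}/n
− O(β²)`, `V₀ = ∫(Re tr)² dHaar > 0`) and EVERY volume, the exact sampler driven by an endpoint-blind
autoregressive model has training loss `≥ d(L+1)^d c(β)²/8`, integrated autocorrelation time
`≥ exp(d(L+1)^d c(β)²/8) − ½` on balanced sign observables and Kish fraction `≤ exp(−d(L+1)^d c(β)²/8)`:
exponential in the volume with a volume-free rate, at strong coupling as at weak coupling
(`Scaling/AutoregressiveGaugeKLExtensiveAllPlanes.wilson_kl_arHybrid_ge_dim_mul_card_site_div_four`).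
NOT CLAIMED: intermediate couplings `β₁ < β < β₀` with a volume-free rate (there the tree has only the
volume-wise positive plaquette mean); the numerical size of `β₁`; other groups.  No `def`, no `sorry`,
nothing cited as a fact beyond the tree.
-/

noncomputable section

namespace Summit.Ventures.LatticeQCDFlow.Theory2.Autoregressive

open MeasureTheory Function Set
open Literature.MathematicalPhysics.QuantumFieldTheory Literature.MathematicalPhysics.QuantumLattice
open Summit.Ventures.LatticeQCDFlow.Exactness Summit.Ventures.LatticeQCDFlow.Scoring
open scoped Matrix Matrix.Norms.Frobenius

section General

variable {d L N : ℕ} {G : Type*} [Group G] [TopologicalSpace G] [IsTopologicalGroup G]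
  [CompactSpace G] [SecondCountableTopology G] [MeasurableSpace G] [BorelSpace G] [NeZero L]
  (ρ : G →* Matrix (Fin N) (Fin N) ℂ)

/-! ## §1 All plaquettes have the same normalised mean; the strong-coupling floor at every plaquette -/

/-- **All plaquettes have the same normalised mean** `⟨(1/N)Re tr ρ(U_{x,ij})⟩_{Λ_L,β}` (`i ≠ j`,
`i' ≠ j'`; continuous `ρ`; translations and axis permutations of the periodic lattice, through the tree's
`wilsonExpectation_plaquetteCost_eq`). [ours] -/
theorem wilsonExpectation_plaquette_eq (hρ : Continuous ρ) (β : ℝ) {x x' : Site d L}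
    {i j i' j' : Fin d} (hij : i ≠ j) (hij' : i' ≠ j') :
    wilsonExpectation ρ β (fun U : GaugeConfig d L G =>
        (N : ℝ)⁻¹ * (ρ (plaquetteHolonomy U x i j)).trace.re) =
      wilsonExpectation ρ β (fun U : GaugeConfig d L G =>
        (N : ℝ)⁻¹ * (ρ (plaquetteHolonomy U x' i' j')).trace.re) := by
  haveI := isProbabilityMeasure_wilsonMeasure (d := d) (L := L) ρ hρ β
  have hc := wilsonExpectation_plaquetteCost_eq (d := d) (L := L) ρ hρ β (x := x) (x' := x') hij hij'
  simp only [wilsonExpectation] at hc ⊢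
  have hXc : ∀ (y : Site d L) (k m : Fin d),
      Continuous fun U : GaugeConfig d L G => (ρ (plaquetteHolonomy U y k m)).trace.re := fun y k m =>
    (Complex.continuous_re.comp hρ.matrix_trace).comp (by unfold plaquetteHolonomy; fun_prop)
  have hXi : ∀ (y : Site d L) (k m : Fin d),
      Integrable (fun U : GaugeConfig d L G => (ρ (plaquetteHolonomy U y k m)).trace.re) (wilsonMeasure ρ β) :=
    fun y k m => Literature.Probability.LatticeModels.integrable_of_continuous_compactSpace _ (hXc y k m)
  rw [integral_sub (integrable_const _) (hXi x i j), integral_sub (integrable_const _) (hXi x' i' j')] at hc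
  rw [integral_const_mul, integral_const_mul]
  congr 1
  linarith

end General

section SpecialUnitary

variable {d N : ℕ} {G : Type*} [Group G] [TopologicalSpace G] [IsTopologicalGroup G]
  [CompactSpace G] [MeasurableSpace G] [BorelSpace G] (ρ : G →* Matrix (Fin N) (Fin N) ℂ)

/-- **The strong-coupling plaquette floor at EVERY plaquette**: for an `SU(n)` model `ρ`
(`IsSpecialUnitaryModel ρ`), `n ≥ 2`, `d ≥ 2`, `L ≥ 2`, `0 ≤ β ≤ β₁` and every plaquette `p` of
`(ℤ/(L+1))^d`: `n⁻¹ β e^{−2βn} V₀ − (2e^{1/2})^{4·2^d d²} (β/β₁)² ≤ ⟨(1/n)Re tr ρ(U_p)⟩_{Λ_{L+1},β}`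
(the tree's `wilsonExpectation_plaquette_ge` at the `(0,1)`-plaquette at the origin, moved to `p` by
`wilsonExpectation_plaquette_eq`). [ours] -/
theorem wilsonExpectation_plaquette_ge_strongCoupling (hρ : IsSpecialUnitaryModel ρ) (hN : 2 ≤ N)
    (hd : 2 ≤ d) {L : ℕ} (hL : 2 ≤ L) {β : ℝ} (hβ0 : 0 ≤ β) (hβ : β ≤ betaOne d ρ)
    (p : Plaquette d (L + 1)) :
    (N : ℝ)⁻¹ * (β * Real.exp (-(2 * β * N)) * PlaquetteLowerBound.charVariance ρ) -
        (2 * Real.exp (1 / 2)) ^ (4 * (2 ^ d * (d * d))) * (β / betaOne d ρ) ^ 2 ≤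
      wilsonExpectation (L := L + 1) ρ β (fun U : GaugeConfig d (L + 1) G =>
        (N : ℝ)⁻¹ * (ρ (plaquetteHolonomy U p.1 p.2.1.1 p.2.1.2)).trace.re) := by
  haveI := IsSpecialUnitaryModel.secondCountableTopology ρ hρ
  haveI : NeZero d := ⟨by omega⟩
  have h01 : (0 : Fin d) ≠ 1 := by
    rw [Ne, Fin.ext_iff, Fin.val_zero, Fin.val_one', Nat.one_mod_eq_one.2 (by omega)]
    norm_num
  have h := PlaquetteLowerBound.wilsonExpectation_plaquette_ge (d := d) ρ hρ hN h01 hL hβ0 hβ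
  -- the `1 × 1` Wilson loop is the normalised plaquette trace
  have hloop : ∀ (x : Site d (L + 1)) (i j : Fin d), wilsonLoop ρ x i j 1 1 =
      fun U : GaugeConfig d (L + 1) G => (N : ℝ)⁻¹ * (ρ (plaquetteHolonomy U x i j)).trace.re := by
    intro x i j
    funext U
    simp [wilsonLoop, rectangleHolonomy, lineHolonomy, plaquetteHolonomy, Site.shift]
  rw [hloop, wilsonExpectation_plaquette_eq (L := L + 1) ρ hρ.1 β h01
    (ne_of_lt p.2.2) (x' := p.1)] at h
  exact h

end SpecialUnitary

/-! ## §2 The volume law at strong coupling for `SU(n)` -/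

section SUN

variable {d : ℕ} (n : ℕ)

/-- **THE VOLUME LAW FOR THE TRAINING LOSS AT STRONG COUPLING, `SU(n)`.**  `n ≥ 2`, `d ≥ 2`, torus
`(ℤ/(L+1))^d` with `L ≥ 2`, `0 < β ≤ β₁` with `0 ≤ c(β)`; `q` squeezed normalised conditionals; `l` a
duplicate-free list of ALL links not read ahead; `q_e` blind at an endpoint `Y e` of every link `e`.  Then
`(d·(L+1)^d/4)·c(β)²/2 ≤ KL(e^{−βS_W}/Z ‖ H_l)`. [ours] -/
theorem sun_kl_arHybrid_ge_strongCoupling (hn : 2 ≤ n) (hd : 2 ≤ d) {L : ℕ} (hL : 2 ≤ L)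
    {β : ℝ} (hβ : 0 < β) (hβ1 : β ≤ betaOne d (fundamentalRep (Fin n)))
    (hc : 0 ≤ (n : ℝ)⁻¹ * (β * Real.exp (-(2 * β * n)) *
        PlaquetteLowerBound.charVariance (fundamentalRep (Fin n))) -
      (2 * Real.exp (1 / 2)) ^ (4 * (2 ^ d * (d * d))) * (β / betaOne d (fundamentalRep (Fin n))) ^ 2)
    {q : Edge d (L + 1) → GaugeConfig d (L + 1) (Matrix.specialUnitaryGroup (Fin n) ℂ) → ℝ}
    (hqm : ∀ a, Measurable (q a)) {cq Cq : ℝ} (hcq : 0 < cq)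
    (hqlo : ∀ a U, cq ≤ q a U) (hqhi : ∀ a U, q a U ≤ Cq)
    (hq1 : ∀ a U, ∫ v, q a (update U a v) ∂(haarProbability (Matrix.specialUnitaryGroup (Fin n) ℂ)) = 1)
    (l : List (Edge d (L + 1))) (hl : l.Nodup) (hall : ∀ e : Edge d (L + 1), e ∈ l)
    (hpw : l.Pairwise (fun a b => ∀ (U : GaugeConfig d (L + 1) (Matrix.specialUnitaryGroup (Fin n) ℂ))
      (v : Matrix.specialUnitaryGroup (Fin n) ℂ), q a (update U b v) = q a U))
    (Y : Edge d (L + 1) → Site d (L + 1)) (hY : ∀ e : Edge d (L + 1), e.1 = Y e ∨ e.1.shift e.2 = Y e)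
    (hqB : ∀ e e' : Edge d (L + 1), e'.1 = Y e ∨ e'.1.shift e'.2 = Y e → e' ≠ e →
      ∀ (U : GaugeConfig d (L + 1) (Matrix.specialUnitaryGroup (Fin n) ℂ))
        (v : Matrix.specialUnitaryGroup (Fin n) ℂ), q e (update U e' v) = q e U) :
    (d : ℝ) * (L + 1) ^ d / 4 * ((n : ℝ)⁻¹ * (β * Real.exp (-(2 * β * n)) *
        PlaquetteLowerBound.charVariance (fundamentalRep (Fin n))) -
      (2 * Real.exp (1 / 2)) ^ (4 * (2 ^ d * (d * d))) * (β / betaOne d (fundamentalRep (Fin n))) ^ 2) ^ 2 / 2 ≤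
      ∫ U, Real.exp (-β * wilsonAction (fundamentalRep (Fin n)) U) /
            (∫ W, Real.exp (-β * wilsonAction (fundamentalRep (Fin n)) W)
              ∂Measure.pi (fun _ : Edge d (L + 1) => haarProbability (Matrix.specialUnitaryGroup (Fin n) ℂ))) *
          Real.log ((Real.exp (-β * wilsonAction (fundamentalRep (Fin n)) U) /
              ∫ W, Real.exp (-β * wilsonAction (fundamentalRep (Fin n)) W)
                ∂Measure.pi (fun _ : Edge d (L + 1) => haarProbability (Matrix.specialUnitaryGroup (Fin n) ℂ))) /
            ((l.map fun b => q b U).prod *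
                coordAvg (haarProbability (Matrix.specialUnitaryGroup (Fin n) ℂ)) l.toFinset
                  (fun V : GaugeConfig d (L + 1) (Matrix.specialUnitaryGroup (Fin n) ℂ) =>
                    Real.exp (-β * wilsonAction (fundamentalRep (Fin n)) V)) U /
              ∫ W, Real.exp (-β * wilsonAction (fundamentalRep (Fin n)) W)
                ∂Measure.pi (fun _ : Edge d (L + 1) => haarProbability (Matrix.specialUnitaryGroup (Fin n) ℂ))))
        ∂Measure.pi (fun _ : Edge d (L + 1) => haarProbability (Matrix.specialUnitaryGroup (Fin n) ℂ)) := by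
  haveI : SecondCountableTopology (Matrix.specialUnitaryGroup (Fin n) ℂ) :=
    Topology.IsEmbedding.subtypeVal.secondCountableTopology
  haveI : NeZero n := ⟨by omega⟩
  have hn0 : 0 < n := by omega
  -- the central element `ω·1 ∈ SU(n)`, `ω = e^{2πi/n} ≠ 1`
  set ω : ℂ := Complex.exp (2 * Real.pi * Complex.I / n) with hωdef
  have hprim : IsPrimitiveRoot ω n := by
    rw [hωdef]; exact Complex.isPrimitiveRoot_exp n (by exact_mod_cast hn0.ne')
  have hωn : ω ^ n = 1 := hprim.pow_eq_one
  have hne : ω ≠ 1 := hprim.ne_one hn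
  have hω : fundamentalRep (Fin n) (Literature.Barriers.QuantumFields.scalarCenter n ω hωn hn0) =
      ω • (1 : Matrix (Fin n) (Fin n) ℂ) := rfl
  have hmain := wilson_kl_arHybrid_ge_dim_mul_card_site_div_four_mul_sq (d := d) (L := L + 1)
    (fundamentalRep (Fin n)) hd (continuous_fundamentalRep (Fin n)) (by omega) hω hne hc
    (fun p => wilsonExpectation_plaquette_ge_strongCoupling (fundamentalRep (Fin n))
      (TorusAreaLaw.isSpecialUnitaryModel_fundamentalRep n) hn hd hL hβ.le hβ1 p)
    hqm hcq hqlo hqhi hq1 l hl hall hpw Y hY hqB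
  rw [show Fintype.card (Site d (L + 1)) = (L + 1) ^ d by simp [Site, ZMod.card]] at hmain
  push_cast at hmain
  exact hmain

/-! ## §3 Exponential slowing down in the volume at strong coupling, `SU(n)` -/

/-- **`τ_int(g) ≥ exp((d·(L+1)^d/4)·c(β)²/2) − ½` at strong coupling, `SU(n)`**, for every measurable
balanced sign observable `g` of the exact independence sampler (hypotheses of
`sun_kl_arHybrid_ge_strongCoupling`). [ours] -/
theorem sun_tauInt_sign_ge_exp_strongCoupling (hn : 2 ≤ n) (hd : 2 ≤ d) {L : ℕ} (hL : 2 ≤ L)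
    {β : ℝ} (hβ : 0 < β) (hβ1 : β ≤ betaOne d (fundamentalRep (Fin n)))
    (hc : 0 ≤ (n : ℝ)⁻¹ * (β * Real.exp (-(2 * β * n)) *
        PlaquetteLowerBound.charVariance (fundamentalRep (Fin n))) -
      (2 * Real.exp (1 / 2)) ^ (4 * (2 ^ d * (d * d))) * (β / betaOne d (fundamentalRep (Fin n))) ^ 2)
    {q : Edge d (L + 1) → GaugeConfig d (L + 1) (Matrix.specialUnitaryGroup (Fin n) ℂ) → ℝ}
    (hqm : ∀ a, Measurable (q a)) {cq Cq : ℝ} (hcq : 0 < cq)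
    (hqlo : ∀ a U, cq ≤ q a U) (hqhi : ∀ a U, q a U ≤ Cq)
    (hq1 : ∀ a U, ∫ v, q a (update U a v) ∂(haarProbability (Matrix.specialUnitaryGroup (Fin n) ℂ)) = 1)
    (l : List (Edge d (L + 1))) (hl : l.Nodup) (hall : ∀ e : Edge d (L + 1), e ∈ l)
    (hpw : l.Pairwise (fun a b => ∀ (U : GaugeConfig d (L + 1) (Matrix.specialUnitaryGroup (Fin n) ℂ))
      (v : Matrix.specialUnitaryGroup (Fin n) ℂ), q a (update U b v) = q a U))
    (Y : Edge d (L + 1) → Site d (L + 1)) (hY : ∀ e : Edge d (L + 1), e.1 = Y e ∨ e.1.shift e.2 = Y e)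
    (hqB : ∀ e e' : Edge d (L + 1), e'.1 = Y e ∨ e'.1.shift e'.2 = Y e → e' ≠ e →
      ∀ (U : GaugeConfig d (L + 1) (Matrix.specialUnitaryGroup (Fin n) ℂ))
        (v : Matrix.specialUnitaryGroup (Fin n) ℂ), q e (update U e' v) = q e U)
    {g : GaugeConfig d (L + 1) (Matrix.specialUnitaryGroup (Fin n) ℂ) → ℝ} (hgm : Measurable g)
    (hg1 : ∀ U, g U ^ 2 = 1)
    (hg0 : ∫ U, g U * Real.exp (-β * wilsonAction (fundamentalRep (Fin n)) U)
      ∂Measure.pi (fun _ : Edge d (L + 1) => haarProbability (Matrix.specialUnitaryGroup (Fin n) ℂ)) = 0) :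
    Real.exp ((d : ℝ) * (L + 1) ^ d / 4 * ((n : ℝ)⁻¹ * (β * Real.exp (-(2 * β * n)) *
        PlaquetteLowerBound.charVariance (fundamentalRep (Fin n))) -
      (2 * Real.exp (1 / 2)) ^ (4 * (2 ^ d * (d * d))) * (β / betaOne d (fundamentalRep (Fin n))) ^ 2) ^ 2 / 2) - 1 / 2 ≤
      tauInt (fun k => (∫ U, g U * ((imhOp
          (Measure.pi fun _ : Edge d (L + 1) => haarProbability (Matrix.specialUnitaryGroup (Fin n) ℂ))
          (fun V : GaugeConfig d (L + 1) (Matrix.specialUnitaryGroup (Fin n) ℂ) =>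
            Real.exp (-β * wilsonAction (fundamentalRep (Fin n)) V))
          (fun V : GaugeConfig d (L + 1) (Matrix.specialUnitaryGroup (Fin n) ℂ) =>
            (l.map fun b => q b V).prod *
              coordAvg (haarProbability (Matrix.specialUnitaryGroup (Fin n) ℂ)) l.toFinset
                (fun V' : GaugeConfig d (L + 1) (Matrix.specialUnitaryGroup (Fin n) ℂ) =>
                  Real.exp (-β * wilsonAction (fundamentalRep (Fin n)) V')) V /
            ∫ W, Real.exp (-β * wilsonAction (fundamentalRep (Fin n)) W)
              ∂Measure.pi (fun _ : Edge d (L + 1) => haarProbability (Matrix.specialUnitaryGroup (Fin n) ℂ))))^[k]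
            g) U * Real.exp (-β * wilsonAction (fundamentalRep (Fin n)) U)
          ∂Measure.pi (fun _ : Edge d (L + 1) => haarProbability (Matrix.specialUnitaryGroup (Fin n) ℂ))) /
        ∫ U, g U ^ 2 * Real.exp (-β * wilsonAction (fundamentalRep (Fin n)) U)
          ∂Measure.pi (fun _ : Edge d (L + 1) => haarProbability (Matrix.specialUnitaryGroup (Fin n) ℂ))) := by
  haveI : SecondCountableTopology (Matrix.specialUnitaryGroup (Fin n) ℂ) :=
    Topology.IsEmbedding.subtypeVal.secondCountableTopology
  haveI : NeZero n := ⟨by omega⟩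
  have hn0 : 0 < n := by omega
  -- the central element `ω·1 ∈ SU(n)`, `ω = e^{2πi/n} ≠ 1`
  set ω : ℂ := Complex.exp (2 * Real.pi * Complex.I / n) with hωdef
  have hprim : IsPrimitiveRoot ω n := by
    rw [hωdef]; exact Complex.isPrimitiveRoot_exp n (by exact_mod_cast hn0.ne')
  have hωn : ω ^ n = 1 := hprim.pow_eq_one
  have hne : ω ≠ 1 := hprim.ne_one hn
  have hω : fundamentalRep (Fin n) (Literature.Barriers.QuantumFields.scalarCenter n ω hωn hn0) =
      ω • (1 : Matrix (Fin n) (Fin n) ℂ) := rfl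
  have hmain := wilson_tauInt_sign_ge_exp_dim_mul_card_site_div_four_mul_sq (d := d) (L := L + 1)
    (fundamentalRep (Fin n)) hd (continuous_fundamentalRep (Fin n)) (by omega) hω hne hc
    (fun p => wilsonExpectation_plaquette_ge_strongCoupling (fundamentalRep (Fin n))
      (TorusAreaLaw.isSpecialUnitaryModel_fundamentalRep n) hn hd hL hβ.le hβ1 p)
    hqm hcq hqlo hqhi hq1 l hl hall hpw Y hY hqB hgm hg1 hg0
  rw [show Fintype.card (Site d (L + 1)) = (L + 1) ^ d by simp [Site, ZMod.card]] at hmain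
  push_cast at hmain
  exact hmain

/-- **`1/κ ≥ exp((d·(L+1)^d/4)·c(β)²/2)` at strong coupling, `SU(n)`** — the Kish fraction of the
reweighting estimator on such a model is exponentially small in the volume, volume-free rate. [ours] -/
theorem sun_invKish_ge_exp_strongCoupling (hn : 2 ≤ n) (hd : 2 ≤ d) {L : ℕ} (hL : 2 ≤ L)
    {β : ℝ} (hβ : 0 < β) (hβ1 : β ≤ betaOne d (fundamentalRep (Fin n)))
    (hc : 0 ≤ (n : ℝ)⁻¹ * (β * Real.exp (-(2 * β * n)) *
        PlaquetteLowerBound.charVariance (fundamentalRep (Fin n))) -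
      (2 * Real.exp (1 / 2)) ^ (4 * (2 ^ d * (d * d))) * (β / betaOne d (fundamentalRep (Fin n))) ^ 2)
    {q : Edge d (L + 1) → GaugeConfig d (L + 1) (Matrix.specialUnitaryGroup (Fin n) ℂ) → ℝ}
    (hqm : ∀ a, Measurable (q a)) {cq Cq : ℝ} (hcq : 0 < cq)
    (hqlo : ∀ a U, cq ≤ q a U) (hqhi : ∀ a U, q a U ≤ Cq)
    (hq1 : ∀ a U, ∫ v, q a (update U a v) ∂(haarProbability (Matrix.specialUnitaryGroup (Fin n) ℂ)) = 1)
    (l : List (Edge d (L + 1))) (hl : l.Nodup) (hall : ∀ e : Edge d (L + 1), e ∈ l)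
    (hpw : l.Pairwise (fun a b => ∀ (U : GaugeConfig d (L + 1) (Matrix.specialUnitaryGroup (Fin n) ℂ))
      (v : Matrix.specialUnitaryGroup (Fin n) ℂ), q a (update U b v) = q a U))
    (Y : Edge d (L + 1) → Site d (L + 1)) (hY : ∀ e : Edge d (L + 1), e.1 = Y e ∨ e.1.shift e.2 = Y e)
    (hqB : ∀ e e' : Edge d (L + 1), e'.1 = Y e ∨ e'.1.shift e'.2 = Y e → e' ≠ e →
      ∀ (U : GaugeConfig d (L + 1) (Matrix.specialUnitaryGroup (Fin n) ℂ))
        (v : Matrix.specialUnitaryGroup (Fin n) ℂ), q e (update U e' v) = q e U) :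
    Real.exp ((d : ℝ) * (L + 1) ^ d / 4 * ((n : ℝ)⁻¹ * (β * Real.exp (-(2 * β * n)) *
        PlaquetteLowerBound.charVariance (fundamentalRep (Fin n))) -
      (2 * Real.exp (1 / 2)) ^ (4 * (2 ^ d * (d * d))) * (β / betaOne d (fundamentalRep (Fin n))) ^ 2) ^ 2 / 2) ≤
      (∫ U, Real.exp (-β * wilsonAction (fundamentalRep (Fin n)) U) /
            ((l.map fun b => q b U).prod *
                coordAvg (haarProbability (Matrix.specialUnitaryGroup (Fin n) ℂ)) l.toFinset
                  (fun V : GaugeConfig d (L + 1) (Matrix.specialUnitaryGroup (Fin n) ℂ) =>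
                    Real.exp (-β * wilsonAction (fundamentalRep (Fin n)) V)) U /
              ∫ W, Real.exp (-β * wilsonAction (fundamentalRep (Fin n)) W)
                ∂Measure.pi (fun _ : Edge d (L + 1) => haarProbability (Matrix.specialUnitaryGroup (Fin n) ℂ))) *
          Real.exp (-β * wilsonAction (fundamentalRep (Fin n)) U)
          ∂Measure.pi (fun _ : Edge d (L + 1) => haarProbability (Matrix.specialUnitaryGroup (Fin n) ℂ))) /
        (∫ W, Real.exp (-β * wilsonAction (fundamentalRep (Fin n)) W)
          ∂Measure.pi (fun _ : Edge d (L + 1) => haarProbability (Matrix.specialUnitaryGroup (Fin n) ℂ))) ^ 2 := by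
  haveI : SecondCountableTopology (Matrix.specialUnitaryGroup (Fin n) ℂ) :=
    Topology.IsEmbedding.subtypeVal.secondCountableTopology
  haveI : NeZero n := ⟨by omega⟩
  have hn0 : 0 < n := by omega
  -- the central element `ω·1 ∈ SU(n)`, `ω = e^{2πi/n} ≠ 1`
  set ω : ℂ := Complex.exp (2 * Real.pi * Complex.I / n) with hωdef
  have hprim : IsPrimitiveRoot ω n := by
    rw [hωdef]; exact Complex.isPrimitiveRoot_exp n (by exact_mod_cast hn0.ne')
  have hωn : ω ^ n = 1 := hprim.pow_eq_one
  have hne : ω ≠ 1 := hprim.ne_one hn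
  have hω : fundamentalRep (Fin n) (Literature.Barriers.QuantumFields.scalarCenter n ω hωn hn0) =
      ω • (1 : Matrix (Fin n) (Fin n) ℂ) := rfl
  have hmain := wilson_invKish_ge_exp_dim_mul_card_site_div_four_mul_sq (d := d) (L := L + 1)
    (fundamentalRep (Fin n)) hd (continuous_fundamentalRep (Fin n)) (by omega) hω hne hc
    (fun p => wilsonExpectation_plaquette_ge_strongCoupling (fundamentalRep (Fin n))
      (TorusAreaLaw.isSpecialUnitaryModel_fundamentalRep n) hn hd hL hβ.le hβ1 p)
    hqm hcq hqlo hqhi hq1 l hl hall hpw Y hY hqB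
  rw [show Fintype.card (Site d (L + 1)) = (L + 1) ^ d by simp [Site, ZMod.card]] at hmain
  push_cast at hmain
  exact hmain

end SUN

end Summit.Ventures.LatticeQCDFlow.Theory2.Autoregressive

end
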